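import Literature.Analysis.FluidPDE.EulerTimeScaling
import HarnessLib

/-!
# Blow-up clauses under the time-scaling symmetry; the blow-up time in
`Literature.Analysis.FluidPDE.elgindi_euler_blowup`

Topic `Literature/Analysis/FluidPDE`. Sequel to `EulerTimeScaling.lean` (the symmetry
`u ↦ c u(ct, x)`, `p ↦ c² p(ct, x)` of classical Euler solutions, Majda–Bertozzi §1.2
Prop. 1.1 (iii), written with the tree's `Fluid.timeRescale`, and the invariance of the slice
classes). Here the two renderings of vorticity blow-up used in the tree are transported along the
symmetry, and the literal blow-up time `1` of [Elgindi2021] Thm 1 / [ElgindiGhoulMasmoudi2021]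
Thm 1 in the named fact `Literature.Analysis.FluidPDE.elgindi_euler_blowup` (`Axisymmetric.lean`,
**ns.S29 (i)**) is shown to cost no generality, as announced in its docstring ("any other blow-up
time is reached by the time-scaling symmetry"). Elgindi–Ghoul–Masmoudi's construction itself
blows up at a time `T_* ≈ 1` (Cor. 2.2, p. 9 of the held text of arXiv:1910.14071: "there exists
`T_*` so that `λ(s) exp(s) → 1/T_*`"), normalised to `1` in their Theorem 1.

## What is proved here (no definitions, no named facts)

* `VorticityBlowsUpAt.timeRescale`: the `limsup` form `Fluid.VorticityBlowsUpAt u T` gives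
  `VorticityBlowsUpAt (timeRescale c c u) (T / c)` for `c > 0` (`curl (c v) = c curl v`, and
  `s ↦ s/c` maps `𝓝[<] T` to `𝓝[<] (T/c)`).
* The Beale–Kato–Majda integral is exactly scale invariant,
  `∫_{(0,t)} ‖curl (c u(cs, ·))‖_∞ ds = ∫_{(0,ct)} ‖curl u(σ, ·)‖_∞ dσ`
  (`lintegral_eSupNorm_curl_timeRescale`, by the tree's change of variables
  `setLIntegral_Ioo_comp_inv_mul`), hence `lim_{t ↑ T} ∫₀ᵗ ‖ω‖_∞ = ∞` transfers to `T / c`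
  (`tendsto_lintegral_eSupNorm_curl_timeRescale`).
* **`elgindi_euler_blowup_of_blowupTime`**, **`elgindi_euler_blowup_iff_exists_blowupTime`**:
  `elgindi_euler_blowup` (blow-up at `t = 1`) follows from, and is equivalent to, its version
  with an arbitrary blow-up time `T > 0` (scale by `c = T`).

Used from Mathlib: `ContinuousWithinAt.tendsto_nhdsWithin`, `Filter.Tendsto.frequently`,
`div_lt_iff₀`, `lintegral_const_mul'`; from the tree: `setLIntegral_Ioo_comp_inv_mul`
(`NSViscosityRescaling.lean`) and `EulerTimeScaling.lean`.
-/

noncomputable section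

open MeasureTheory Set Function Filter TopologicalSpace WithLp
open _root_.Topology
open scoped ContDiff NNReal ENNReal InnerProductSpace RealInnerProductSpace

namespace Literature.Analysis.FluidPDE

/-! ### The `limsup` form of blow-up under time scaling -/

/-- For `c > 0`, `s ↦ s / c` maps left neighbourhoods of `T` to left neighbourhoods of `T / c`. [folklore] -/
theorem tendsto_div_const_nhdsLT {c : ℝ} (hc : 0 < c) (T : ℝ) :
    Tendsto (fun s : ℝ => s / c) (𝓝[<] T) (𝓝[<] (T / c)) := by
  have hmaps : MapsTo (fun s : ℝ => s / c) (Iio T) (Iio (T / c)) := fun s hs =>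
    div_lt_div_of_pos_right (mem_Iio.1 hs) hc
  have h := ((continuous_id.div_const c).continuousWithinAt (s := Iio T) (x := T)).tendsto_nhdsWithin
    hmaps
  simpa using h

/-- For `c > 0`, `t ↦ c t` maps left neighbourhoods of `T / c` to left neighbourhoods of `T`. [folklore] -/
theorem tendsto_const_mul_nhdsLT {c : ℝ} (hc : 0 < c) (T : ℝ) :
    Tendsto (fun t : ℝ => c * t) (𝓝[<] (T / c)) (𝓝[<] T) := by
  have hmaps : MapsTo (fun t : ℝ => c * t) (Iio (T / c)) (Iio T) := fun t ht => by
    have h := mul_lt_mul_of_pos_left (mem_Iio.1 ht) hc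
    rwa [mul_div_cancel₀ _ hc.ne'] at h
  have hcont : ContinuousWithinAt (fun t : ℝ => c * t) (Iio (T / c)) (T / c) :=
    (continuous_const_mul c).continuousWithinAt
  have h := hcont.tendsto_nhdsWithin hmaps
  rwa [mul_div_cancel₀ _ hc.ne'] at h

/-- **Vorticity blow-up under time scaling**: if `‖ω(t)‖_∞` is unbounded as `t ↑ T` for `u`, it is
unbounded as `t ↑ T/c` for `c u(ct, ·)` (`c > 0`; `curl (c v) = c curl v`). [folklore] -/
theorem VorticityBlowsUpAt.timeRescale {u : ℝ → EuclideanSpace ℝ (Fin 3) → EuclideanSpace ℝ (Fin 3)} {T c : ℝ}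
    (hc : 0 < c)
    (h : VorticityBlowsUpAt u T) : VorticityBlowsUpAt (FluidPDE.timeRescale c c u) (T / c) := by
  intro M
  refine (tendsto_div_const_nhdsLT hc T).frequently ((h (M / c)).mono ?_)
  rintro s ⟨x, hx⟩
  refine ⟨x, ?_⟩
  have hfun : FluidPDE.timeRescale c c u (s / c) = fun y => c • u s y := by
    funext y
    simp [mul_div_cancel₀ s hc.ne']
  rw [hfun, curl_const_smul_field, norm_smul, Real.norm_eq_abs, abs_of_pos hc]
  rw [div_lt_iff₀ hc] at hx
  linarith

/-! ### The Beale–Kato–Majda integral under time scaling -/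

/-- Change of variables `σ = c s` (`c > 0`) in a lower Lebesgue integral over `(0, t)`:
`∫_{(0,t)} g(c s) ds = c⁻¹ ∫_{(0,ct)} g(σ) dσ` (the tree's `setLIntegral_Ioo_comp_inv_mul` with
`ν = c⁻¹`). [folklore] -/
theorem lintegral_Ioo_comp_mul_left {c : ℝ} (hc : 0 < c) (g : ℝ → ℝ≥0∞) (t : ℝ) :
    ∫⁻ s in Ioo 0 t, g (c * s) = ENNReal.ofReal c⁻¹ * ∫⁻ σ in Ioo 0 (c * t), g σ := by
  have h := setLIntegral_Ioo_comp_inv_mul g (inv_pos.2 hc) (c * t)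
  rwa [inv_inv, ← mul_assoc, inv_mul_cancel₀ hc.ne', one_mul] at h

/-- **The Beale–Kato–Majda integral is scale invariant**: for `c > 0`,
`∫_{(0,t)} ‖curl (c u(cs, ·))‖_∞ ds = ∫_{(0,ct)} ‖curl u(σ, ·)‖_∞ dσ`. [folklore] -/
theorem lintegral_eSupNorm_curl_timeRescale (u : ℝ → EuclideanSpace ℝ (Fin 3) → EuclideanSpace ℝ (Fin 3)) {c : ℝ}
    (hc : 0 < c) (t : ℝ) :
    ∫⁻ s in Ioo 0 t, FunctionSpaces.eSupNorm (curl (FluidPDE.timeRescale c c u s)) =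
      ∫⁻ σ in Ioo 0 (c * t), FunctionSpaces.eSupNorm (curl (u σ)) := by
  have h1 : ∀ s, FunctionSpaces.eSupNorm (curl (FluidPDE.timeRescale c c u s)) =
      ‖c‖ₑ * FunctionSpaces.eSupNorm (curl (u (c * s))) := fun s => by
    rw [timeRescale_slice, eSupNorm_curl_const_smul]
  simp_rw [h1]
  rw [lintegral_const_mul' _ _ (by simp),
    lintegral_Ioo_comp_mul_left hc (fun σ => FunctionSpaces.eSupNorm (curl (u σ))) t,
    ← mul_assoc]
  have h2 : ‖c‖ₑ * ENNReal.ofReal c⁻¹ = 1 := by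
    rw [Real.enorm_eq_ofReal hc.le, ← ENNReal.ofReal_mul hc.le, mul_inv_cancel₀ hc.ne',
      ENNReal.ofReal_one]
  rw [h2, one_mul]

/-- **Beale–Kato–Majda blow-up under time scaling**: if `∫₀ᵗ ‖ω(s)‖_∞ ds → ∞` as `t ↑ T` for
`u`, then the same holds as `t ↑ T/c` for `c u(ct, ·)` (`c > 0`). [folklore] -/
theorem tendsto_lintegral_eSupNorm_curl_timeRescale {u : ℝ → EuclideanSpace ℝ (Fin 3) → EuclideanSpace ℝ (Fin 3)}
    {T c : ℝ} (hc : 0 < c)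
    (h : Tendsto (fun t : ℝ => ∫⁻ s in Ioo 0 t, FunctionSpaces.eSupNorm (curl (u s)))
      (𝓝[<] T) (𝓝 ∞)) :
    Tendsto (fun t : ℝ => ∫⁻ s in Ioo 0 t,
      FunctionSpaces.eSupNorm (curl (FluidPDE.timeRescale c c u s))) (𝓝[<] (T / c)) (𝓝 ∞) := by
  simp_rw [lintegral_eSupNorm_curl_timeRescale u hc]
  exact h.comp (tendsto_const_mul_nhdsLT hc T)

/-! ### The blow-up time in `elgindi_euler_blowup` -/

/-- **Scale invariance of the blow-up time in `elgindi_euler_blowup`.** A finite-energy,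
axisymmetric, swirl-free `C^{1,α}` classical Euler solution on `ℝ³ × [0, T)` whose vorticity blows
up at any `T > 0` yields one blowing up at `t = 1`, by the time scaling `u ↦ T u(Tt, x)`,
`p ↦ T² p(Tt, x)` (`IsClassicalEulerOnDomain.timeRescale_zero` and the slice lemmas of
`EulerTimeScaling.lean`). This makes rigorous the remark in the docstring of
`elgindi_euler_blowup` that the literal blow-up time `1` of [Elgindi2021] Thm 1 and
[ElgindiGhoulMasmoudi2021] Thm 1 costs no generality. [folklore] -/
theorem elgindi_euler_blowup_of_blowupTime {T : ℝ} (hT : 0 < T)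
    (h : ∃ α : ℝ≥0, 0 < α ∧
      ∃ (u : ℝ → EuclideanSpace ℝ (Fin 3) → EuclideanSpace ℝ (Fin 3)) (p : ℝ → EuclideanSpace ℝ (Fin 3) → ℝ),
      IsClassicalEulerOnDomain (Ico 0 T) (⊤ : Opens (EuclideanSpace ℝ (Fin 3))) 0 0 u p ∧
      (∀ t ∈ Ico 0 T, MemC1Holder α (u t) ∧ HasFiniteEnergy (u t) ∧
        IsAxisymmetric (u t) ∧ HasNoSwirl (u t)) ∧
      VorticityBlowsUpAt u T) : elgindi_euler_blowup := by
  obtain ⟨α, hα, u, p, hsol, hslice, hblow⟩ := h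
  refine ⟨α, hα, FluidPDE.timeRescale T T u, FluidPDE.timeRescale T (T ^ 2) p, ?_, ?_, ?_⟩
  · have := hsol.timeRescale_zero hT
    rwa [div_self hT.ne'] at this
  · intro t ht
    have hmaps := mapsTo_mul_Ico hT T
    rw [div_self hT.ne'] at hmaps
    obtain ⟨h1, h2, h3, h4⟩ := hslice (T * t) (hmaps ht)
    rw [timeRescale_slice]
    exact ⟨h1.const_smul T, h2.const_smul T, h3.const_smul T, h4.const_smul T⟩
  · have := hblow.timeRescale hT
    rwa [div_self hT.ne'] at this

/-- `elgindi_euler_blowup` is equivalent to its version with an arbitrary positive blow-up time. [folklore] -/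
theorem elgindi_euler_blowup_iff_exists_blowupTime :
    elgindi_euler_blowup ↔ ∃ T : ℝ, 0 < T ∧ ∃ α : ℝ≥0, 0 < α ∧
      ∃ (u : ℝ → EuclideanSpace ℝ (Fin 3) → EuclideanSpace ℝ (Fin 3)) (p : ℝ → EuclideanSpace ℝ (Fin 3) → ℝ),
      IsClassicalEulerOnDomain (Ico 0 T) (⊤ : Opens (EuclideanSpace ℝ (Fin 3))) 0 0 u p ∧
      (∀ t ∈ Ico 0 T, MemC1Holder α (u t) ∧ HasFiniteEnergy (u t) ∧
        IsAxisymmetric (u t) ∧ HasNoSwirl (u t)) ∧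
      VorticityBlowsUpAt u T :=
  ⟨fun ⟨α, hα, u, p, hsol, hslice, hblow⟩ => ⟨1, one_pos, α, hα, u, p, hsol, hslice, hblow⟩,
    fun ⟨_, hT, h⟩ => elgindi_euler_blowup_of_blowupTime hT h⟩

end Literature.Analysis.FluidPDE
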